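import Literature.NumberTheory.Automorphic.Liu2021.Def411WeilCarriersAtLine
import Literature.NumberTheory.Automorphic.UnitaryGroupLevelTransport
import HarnessLib

/-!
# [Liu2021, Def. 4.11]'s carriers `ω(μ, ε, χ)` at a line `⟨a⟩`: transport along a `FinSB`-intertwiner over a CHANGE OF
THE `V`-FORM (frame independence, the coinvariant half)

Topic `NumberTheory/Automorphic/Liu2021`; namespaces `Literature.NumberTheory.GelbartRogawski1991.UnitaryDualPair.WeilCoinv`
(§1, generic central coinvariants `Ω(s, χ)` of a finite-adelic unitary dual pair) and
`Literature.NumberTheory.Automorphic.Liu2021.Def411WeilCarriers` (§2–§3, the carriers `omegaAtLine` ∕ `rhoVAtLine` ∕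
`rhoAtLine` of `Def411WeilCarriersAtLine`).  THEOREMS ONLY (no definition, no named fact, no `sorry`); the transporting equivalence is the tree's `TwistedCoinv.mapEquiv`
written out at the pair data.  Nothing of [Liu2021] is asserted.

WHY.  `omegaAtLine … JV … hs a χ` realises [Liu2021, Def. 4.11]'s `ω(μ, ε, χ)` as the `χ_W`-coinvariants of the finite
Weil representation of the pair `U(J_V) × U(⟨a⟩)` at a compatible pair splitting `s_a` — for ONE Gram matrix `J_V` of the
hermitian space `V`.  A consumer meeting the SAME space in another frame (`J_V′ = ᵗ(cB)·(b • J_V)·B`-related data; the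
Hodge CM programme's GS-6 glue reads `V` once in a rational frame chosen from `V` and once in a frame ADAPTED to a face
`V = V⋆ ⊕ V⊥`) needs `ω(μ, ε, χ)` at `J_V` and at `J_V′` identified, `U(J_V)(𝔸_f) ≃ U(J_V′)(𝔸_f)`-equivariantly along
the conjugation `finAdelicCongr B` ([PlatonovRapinchuk1994, §2.3]).  The Weil-level input is a linear automorphism
`Q : 𝒮((𝔸_F^∞)^{N·M}) ≃ₗ[ℂ] 𝒮((𝔸_F^∞)^{N·M})` of the finite Schwartz–Bruhat module (the finite part of Weil's rational
lift of the comparison isometry) intertwining the two finite Weil representations of the pair: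
`ω′_f(s′(φ k, u)) ∘ Q = Q ∘ ω_f(s(k, u))`.  THIS FILE is the coinvariant half: such a `Q` DESCENDS to the central
coinvariants, `Ψ : Ω(s, χ) ≃ₗ[ℂ] Ω(s′, χ)` with `Ψ ∘ weilCoinv(s, χ)(k) = weilCoinv(s′, χ)(φ k) ∘ Ψ` — the functoriality
of the maximal `χ`-quotient ([GelbartRogawski1991, §3.1 Remark p. 457]; the tree's `TwistedCoinv.mapEquiv` ∕
`mapEquiv_rep`) at the pair data — and the `∃ Ψ` statement of frame independence GIVEN the intertwiner `Q` as a
hypothesis (the construction of `Q` — rational lift, transported splitting, χ-rigidity — is not in this file).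

* §1 (any `N M`, two `V`-forms `J_V J_V′`, one `W`-form; namespace `…UnitaryDualPair.WeilCoinv`):
  `exists_coinv_equiv_weilCoinv` — from a `FinSB`-automorphism `Q` intertwining the `U(J_W)`-members up to units `η u`
  (`χ′ = η·χ`) and the `U(J_V)`-members over a map `φ` on the nose, `∃ Ψ : Coinv (finPairRepW[J_V] hs) χ ≃ₗ[ℂ]
  Coinv (finPairRepW[J_V′] hs′) χ′` with `Ψ [f] = [Q f]` and `Ψ ∘ weilCoinv(s,χ)(k) = weilCoinv(s′,χ′)(φ k) ∘ Ψ`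
  (`TwistedCoinv.mapEquiv` ∕ `mapEquiv_rep`); the pair-level `LinearEquiv.conj` hypothesis unpacked
  (`finPairRepW_conj_apply`, `finPairRepV_conj_apply`).
* §2 (`M = 1`, the line `⟨a⟩`, `χ ∈ Chi`; namespace `…Liu2021.Def411WeilCarriers`): `exists_omegaAtLine_equiv_rhoVAtLine`
  (any map `φ`), `exists_omegaAtLine_equiv_rhoVAtLine_finAdelicCongr` ∕ `…_of_finPairRep_conj` — `∃ Ψ, ∀ k x,
  Ψ (rhoVAtLine[J_V] k x) = rhoVAtLine[J_V′] (finAdelicCongr B hb hB k) (Ψ x)` from an intertwiner `Q` over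
  `finAdelicCongr B hb hB` (pointwise form ∕ pair-level `conj` form).

## References
* [Liu2021] Y. Liu, *Fourier–Jacobi cycles and arithmetic relative trace formula*, Camb. J. Math. 9 (2021) =
  arXiv:2102.11518: Def. 4.11 (l. 2092–2096), App. D §D.1 Steps 2–3 (l. 5217–5221), App. C (l. 4624).
* [GelbartRogawski1991] S. Gelbart, J. Rogawski, *L-functions and Fourier–Jacobi coefficients for the unitary group
  U(3)*, Invent. Math. 105 (1991), §3.1 Prop. 3.1.1 p. 455, Remark p. 457 L4–13.
* [PlatonovRapinchuk1994] V. Platonov, A. Rapinchuk, *Algebraic groups and number theory*, Academic Press (1994), §2.3.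
-/
noncomputable section

open scoped Matrix Kronecker TensorProduct
open NumberField
open Literature.NumberTheory Literature.NumberTheory.Automorphic Literature.NumberTheory.Automorphic.UnitaryGroup
open Literature.NumberTheory.GelbartRogawski1991 Literature.NumberTheory.GelbartRogawski1991.UnitaryDualPair
open Literature.NumberTheory.Weil1964 Literature.RepresentationTheory

/-! ## §1 Transport of `Ω(s, χ)` along a `FinSB`-intertwiner over a change of the `V`-form -/

namespace Literature.NumberTheory.GelbartRogawski1991.UnitaryDualPair.WeilCoinv

section Transport

variable (F E : Type) [Field F] [NumberField F] [Field E] [NumberField E] [Algebra F E]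
variable (c : E ≃ₐ[F] E) (N M : ℕ) {n : ℕ} (e : Fin N × Fin M ≃ Fin n)
variable (JV JV' : Matrix (Fin N) (Fin N) E) (JW : Matrix (Fin M) (Fin M) E)
variable {TV TV' : Matrix (Fin N) (Fin N) F} {TW : Matrix (Fin M) (Fin M) F}
variable [Algebra.IsQuadraticExtension F E] {δ : E} (hcδ : c δ = -δ) (hδ : δ ≠ 0) {d : F}
  (hd : δ * δ = algebraMap F E d) (hV : TV.IsSymm) (hV' : TV'.IsSymm) (hW : TW.IsSymm) (hVd : IsUnit TV.det)
  (hVd' : IsUnit TV'.det) (hWd : IsUnit TW.det) (hJV : JV = TV.map (algebraMap F E))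
  (hJV' : JV' = TV'.map (algebraMap F E)) (hJW : JW = TW.map (algebraMap F E))
  {s : UnitaryGroup.adelicPair F E c N M JV JW →* adelicMpCont F (Fin n) (adelicGram F e TV TW)}
  {s' : UnitaryGroup.adelicPair F E c N M JV' JW →* adelicMpCont F (Fin n) (adelicGram F e TV' TW)}
  (hs : (splittingDatum F E c N M e JV JW hcδ hδ hd hV hW hVd hWd hJV hJW).IsCompatible s)
  (hs' : (splittingDatum F E c N M e JV' JW hcδ hδ hd hV' hW hVd' hWd hJV' hJW).IsCompatible s')
variable (χ χ' : UnitaryGroup.finAdelic F E c M JW →* ℂˣ) (Q : FinSB F (Fin N × Fin M) ≃ₗ[ℂ] FinSB F (Fin N × Fin M))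

/-- **transport of the central coinvariants `Ω(s, χ) ≃ₗ[ℂ] Ω(s′, χ′)` along a `FinSB`-level linear automorphism `Q`**
intertwining the `U(J_W)`-members of the two finite Weil representations up to units `η u` (`χ′ = η · χ`) and the
`U(J_V)`-members over a map `φ : U(J_V)(𝔸_f) → U(J_V′)(𝔸_f)` on the nose (the two pair splittings `s`, `s′` live over two
`V`-forms `J_V`, `J_V′` of the same rank and the same `W`-form): the maximal `χ`-quotient is functorial —
`Ψ := TwistedCoinv.mapEquiv … Q η …`, `Ψ [f] = [Q f]`, `Ψ ∘ weilCoinv(s,χ)(k) = weilCoinv(s′,χ′)(φ k) ∘ Ψ`.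
[cite: GelbartRogawski1991, §3.1 Remark p. 457 L4–13] -/
theorem exists_coinv_equiv_weilCoinv (η : UnitaryGroup.finAdelic F E c M JW → ℂˣ)
    (hQW : ∀ (u : UnitaryGroup.finAdelic F E c M JW) (f : FinSB F (Fin N × Fin M)),
      finPairRepW F E c N M e JV' JW hcδ hδ hd hV' hW hVd' hWd hJV' hJW hs' u (Q f) =
        ((η u : ℂˣ) : ℂ) • Q (finPairRepW F E c N M e JV JW hcδ hδ hd hV hW hVd hWd hJV hJW hs u f))
    (hχ : ∀ u : UnitaryGroup.finAdelic F E c M JW, χ' u = η u * χ u)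
    (φ : UnitaryGroup.finAdelic F E c N JV → UnitaryGroup.finAdelic F E c N JV')
    (hQV : ∀ (k : UnitaryGroup.finAdelic F E c N JV) (f : FinSB F (Fin N × Fin M)),
      finPairRepV F E c N M e JV' JW hcδ hδ hd hV' hW hVd' hWd hJV' hJW hs' (φ k) (Q f) =
        Q (finPairRepV F E c N M e JV JW hcδ hδ hd hV hW hVd hWd hJV hJW hs k f)) :
    ∃ Ψ : TwistedCoinv.Coinv (finPairRepW F E c N M e JV JW hcδ hδ hd hV hW hVd hWd hJV hJW hs) χ ≃ₗ[ℂ]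
        TwistedCoinv.Coinv (finPairRepW F E c N M e JV' JW hcδ hδ hd hV' hW hVd' hWd hJV' hJW hs') χ',
      (∀ f : FinSB F (Fin N × Fin M), Ψ (TwistedCoinv.mk _ χ f) = TwistedCoinv.mk _ χ' (Q f)) ∧
      ∀ (k : UnitaryGroup.finAdelic F E c N JV)
        (x : TwistedCoinv.Coinv (finPairRepW F E c N M e JV JW hcδ hδ hd hV hW hVd hWd hJV hJW hs) χ),
        Ψ (weilCoinv F E c N M e JV JW hcδ hδ hd hV hW hVd hWd hJV hJW χ hs k x) =
          weilCoinv F E c N M e JV' JW hcδ hδ hd hV' hW hVd' hWd hJV' hJW χ' hs' (φ k) (Ψ x) := by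
  refine ⟨TwistedCoinv.mapEquiv (finPairRepW F E c N M e JV JW hcδ hδ hd hV hW hVd hWd hJV hJW hs) χ
      (finPairRepW F E c N M e JV' JW hcδ hδ hd hV' hW hVd' hWd hJV' hJW hs') χ' Q η hQW hχ, fun f => rfl, fun k x => ?_⟩
  have h := TwistedCoinv.mapEquiv_rep _ χ _ χ' _ _
    (commute_finPairRepV_finPairRepW F E c N M e JV JW hcδ hδ hd hV hW hVd hWd hJV hJW hs)
    (commute_finPairRepV_finPairRepW F E c N M e JV' JW hcδ hδ hd hV' hW hVd' hWd hJV' hJW hs') Q η hQW hχ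
    (g := k) (g' := φ k) (a := (1 : ℂ)) (fun f => by rw [one_smul]; exact hQV k f) x
  rw [one_smul] at h
  exact h.symm

omit hs hs' in
/-- unpacking a PAIR-level conjugation hypothesis, `W`-member: if `ω′_f(s′(φ k, u)) = Q ∘ ω_f(s(k, u)) ∘ Q⁻¹` for all
`(k, u)` and a map `φ` with `φ 1 = 1`, then `ω′_f(s′(1,u)) (Q f) = Q (ω_f(s(1,u)) f)`. [cite: GelbartRogawski1991, §3.1 Prop. 3.1.1 p. 455] -/
theorem finPairRepW_conj_apply
    (hs : (splittingDatum F E c N M e JV JW hcδ hδ hd hV hW hVd hWd hJV hJW).IsCompatible s)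
    (hs' : (splittingDatum F E c N M e JV' JW hcδ hδ hd hV' hW hVd' hWd hJV' hJW).IsCompatible s')
    (φ : UnitaryGroup.finAdelic F E c N JV → UnitaryGroup.finAdelic F E c N JV') (hφ : φ 1 = 1)
    (hconj : ∀ (k : UnitaryGroup.finAdelic F E c N JV) (u : UnitaryGroup.finAdelic F E c M JW),
      finPairRep F E c N M e JV' JW hcδ hδ hd hV' hW hVd' hWd hJV' hJW hs' (φ k, u) =
        Q.conj (finPairRep F E c N M e JV JW hcδ hδ hd hV hW hVd hWd hJV hJW hs (k, u)))
    (u : UnitaryGroup.finAdelic F E c M JW) (f : FinSB F (Fin N × Fin M)) :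
    finPairRepW F E c N M e JV' JW hcδ hδ hd hV' hW hVd' hWd hJV' hJW hs' u (Q f) =
      Q (finPairRepW F E c N M e JV JW hcδ hδ hd hV hW hVd hWd hJV hJW hs u f) := by
  have h := hconj 1 u
  rw [hφ] at h
  rw [finPairRepW_apply, finPairRepW_apply, h, LinearEquiv.conj_apply_apply, LinearEquiv.symm_apply_apply]

omit hs hs' in
/-- unpacking a PAIR-level conjugation hypothesis, `V`-member: `ω′_f(s′(φ k, 1)) (Q f) = Q (ω_f(s(k,1)) f)`.
[cite: GelbartRogawski1991, §3.1 Prop. 3.1.1 p. 455] -/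
theorem finPairRepV_conj_apply
    (hs : (splittingDatum F E c N M e JV JW hcδ hδ hd hV hW hVd hWd hJV hJW).IsCompatible s)
    (hs' : (splittingDatum F E c N M e JV' JW hcδ hδ hd hV' hW hVd' hWd hJV' hJW).IsCompatible s')
    (φ : UnitaryGroup.finAdelic F E c N JV → UnitaryGroup.finAdelic F E c N JV')
    (hconj : ∀ (k : UnitaryGroup.finAdelic F E c N JV) (u : UnitaryGroup.finAdelic F E c M JW),
      finPairRep F E c N M e JV' JW hcδ hδ hd hV' hW hVd' hWd hJV' hJW hs' (φ k, u) =
        Q.conj (finPairRep F E c N M e JV JW hcδ hδ hd hV hW hVd hWd hJV hJW hs (k, u)))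
    (k : UnitaryGroup.finAdelic F E c N JV) (f : FinSB F (Fin N × Fin M)) :
    finPairRepV F E c N M e JV' JW hcδ hδ hd hV' hW hVd' hWd hJV' hJW hs' (φ k) (Q f) =
      Q (finPairRepV F E c N M e JV JW hcδ hδ hd hV hW hVd hWd hJV hJW hs k f) := by
  rw [finPairRepV_apply, finPairRepV_apply, hconj k 1, LinearEquiv.conj_apply_apply, LinearEquiv.symm_apply_apply]

end Transport

end Literature.NumberTheory.GelbartRogawski1991.UnitaryDualPair.WeilCoinv

/-! ## §2 At the line `⟨a⟩`: frame independence of `ω(μ,ε,χ)` as an `∃ Ψ` statement -/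

namespace Literature.NumberTheory.Automorphic.Liu2021.Def411WeilCarriers

open Literature.NumberTheory.GelbartRogawski1991.UnitaryDualPair.WeilCoinv

section AtLine

variable (F E : Type) [Field F] [NumberField F] [Field E] [NumberField E] [Algebra F E]
variable (c : E ≃ₐ[F] E) (N : ℕ) {n : ℕ} (e : Fin N × Fin 1 ≃ Fin n)
variable (JV JV' : Matrix (Fin N) (Fin N) E) {TV TV' : Matrix (Fin N) (Fin N) F}
variable [Algebra.IsQuadraticExtension F E] {δ : E} (hcδ : c δ = -δ) (hδ : δ ≠ 0) {d : F}
  (hd : δ * δ = algebraMap F E d) (hV : TV.IsSymm) (hV' : TV'.IsSymm) (hVd : IsUnit TV.det) (hVd' : IsUnit TV'.det)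
  (hJV : JV = TV.map (algebraMap F E)) (hJV' : JV' = TV'.map (algebraMap F E))
  {s : ∀ a : Fˣ, UnitaryGroup.adelicPair F E c N 1 JV (JW F E a) →* adelicMpCont F (Fin n) (adelicGram F e TV (TW F a))}
  {s' : ∀ a : Fˣ, UnitaryGroup.adelicPair F E c N 1 JV' (JW F E a) →* adelicMpCont F (Fin n) (adelicGram F e TV' (TW F a))}
  (hs : ∀ a : Fˣ, (splittingDatum F E c N 1 e JV (JW F E a) hcδ hδ hd hV (isSymm_TW F a) hVd (isUnit_det_TW F a) hJV
    (JW_eq F E a)).IsCompatible (s a))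
  (hs' : ∀ a : Fˣ, (splittingDatum F E c N 1 e JV' (JW F E a) hcδ hδ hd hV' (isSymm_TW F a) hVd' (isUnit_det_TW F a) hJV'
    (JW_eq F E a)).IsCompatible (s' a))
variable (a : Fˣ) (χ : Chi F E c)

/-- **frame independence of `ω(μ,ε,χ)` at the line `⟨a⟩`, modulo its `FinSB`-level content**: a `FinSB`-automorphism `Q`
commuting with the `U(⟨a⟩)`-members on the nose and intertwining the `U(J_V)`-members over a map `φ` gives
`Ψ : omegaAtLine[J_V] hs a χ ≃ₗ[ℂ] omegaAtLine[J_V′] hs′ a χ` with `Ψ (rhoVAtLine[J_V] k x) = rhoVAtLine[J_V′] (φ k) (Ψ x)`.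
[cite: Liu2021, Def. 4.11 (l. 2092–2096); App. D §D.1 Steps 2–3 (l. 5217–5221)] [cite: GelbartRogawski1991, §3.1 Remark p. 457 L4–13] -/
theorem exists_omegaAtLine_equiv_rhoVAtLine (Q : FinSB F (Fin N × Fin 1) ≃ₗ[ℂ] FinSB F (Fin N × Fin 1))
    (hQW : ∀ (u : UnitaryGroup.finAdelic F E c 1 (JW F E a)) (f : FinSB F (Fin N × Fin 1)),
      finPairRepW F E c N 1 e JV' (JW F E a) hcδ hδ hd hV' (isSymm_TW F a) hVd' (isUnit_det_TW F a) hJV' (JW_eq F E a)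
          (hs' a) u (Q f) =
        Q (finPairRepW F E c N 1 e JV (JW F E a) hcδ hδ hd hV (isSymm_TW F a) hVd (isUnit_det_TW F a) hJV (JW_eq F E a)
          (hs a) u f))
    (φ : UnitaryGroup.finAdelic F E c N JV → UnitaryGroup.finAdelic F E c N JV')
    (hQV : ∀ (k : UnitaryGroup.finAdelic F E c N JV) (f : FinSB F (Fin N × Fin 1)),
      finPairRepV F E c N 1 e JV' (JW F E a) hcδ hδ hd hV' (isSymm_TW F a) hVd' (isUnit_det_TW F a) hJV' (JW_eq F E a)
          (hs' a) (φ k) (Q f) =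
        Q (finPairRepV F E c N 1 e JV (JW F E a) hcδ hδ hd hV (isSymm_TW F a) hVd (isUnit_det_TW F a) hJV (JW_eq F E a)
          (hs a) k f)) :
    ∃ Ψ : omegaAtLine F E c N e JV hcδ hδ hd hV hVd hJV hs a χ ≃ₗ[ℂ] omegaAtLine F E c N e JV' hcδ hδ hd hV' hVd' hJV' hs' a χ,
      ∀ (k : UnitaryGroup.finAdelic F E c N JV) (x : omegaAtLine F E c N e JV hcδ hδ hd hV hVd hJV hs a χ),
        Ψ (rhoVAtLine F E c N e JV hcδ hδ hd hV hVd hJV hs a χ k x) =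
          rhoVAtLine F E c N e JV' hcδ hδ hd hV' hVd' hJV' hs' a χ (φ k) (Ψ x) := by
  obtain ⟨Ψ, -, hΨ⟩ := exists_coinv_equiv_weilCoinv F E c N 1 e JV JV' (JW F E a) hcδ hδ hd hV hV' (isSymm_TW F a) hVd
    hVd' (isUnit_det_TW F a) hJV hJV' (JW_eq F E a) (hs a) (hs' a) (lineChar F E c a χ.1) (lineChar F E c a χ.1) Q 1
    (fun u f => by rw [Pi.one_apply, Units.val_one, one_smul]; exact hQW u f) (fun u => by rw [Pi.one_apply, one_mul])
    φ hQV
  exact ⟨Ψ, hΨ⟩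

/-- **frame independence of `ω(μ,ε,χ)` over the conjugation `finAdelicCongr` by a rational similitude** (`ᵗ(cB)·(b • J_V′)·B =
J_V`): if the finite Weil representations of the pair at `(J_V, ⟨a⟩, s_a)` and at `(J_V′, ⟨a⟩, s′_a)` are intertwined by some
linear automorphism `Q` of `𝒮((𝔸_F^∞)^N)` — identically on the `U(⟨a⟩)`-member, over `finAdelicCongr B` on the
`U(J_V)`-member — then `ω(μ,ε,χ)` at `J_V` and at `J_V′` are isomorphic `U(J_V)(𝔸_f) ≃ U(J_V′)(𝔸_f)`-equivariantly.
[cite: Liu2021, Def. 4.11 (l. 2092–2096)] [cite: GelbartRogawski1991, §3.1 Remark p. 457 L4–13] [cite: PlatonovRapinchuk1994, §2.3] -/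
theorem exists_omegaAtLine_equiv_rhoVAtLine_finAdelicCongr (B : GL (Fin N) E) {b : E} (hb : b ≠ 0)
    (hB : formCongr (c : E →+* E) B (b • JV') = JV)
    (hQ : ∃ Q : FinSB F (Fin N × Fin 1) ≃ₗ[ℂ] FinSB F (Fin N × Fin 1),
      (∀ (u : UnitaryGroup.finAdelic F E c 1 (JW F E a)) (f : FinSB F (Fin N × Fin 1)),
        finPairRepW F E c N 1 e JV' (JW F E a) hcδ hδ hd hV' (isSymm_TW F a) hVd' (isUnit_det_TW F a) hJV' (JW_eq F E a)
            (hs' a) u (Q f) =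
          Q (finPairRepW F E c N 1 e JV (JW F E a) hcδ hδ hd hV (isSymm_TW F a) hVd (isUnit_det_TW F a) hJV (JW_eq F E a)
            (hs a) u f)) ∧
      ∀ (k : UnitaryGroup.finAdelic F E c N JV) (f : FinSB F (Fin N × Fin 1)),
        finPairRepV F E c N 1 e JV' (JW F E a) hcδ hδ hd hV' (isSymm_TW F a) hVd' (isUnit_det_TW F a) hJV' (JW_eq F E a)
            (hs' a) (finAdelicCongr F E c B hb hB k) (Q f) =
          Q (finPairRepV F E c N 1 e JV (JW F E a) hcδ hδ hd hV (isSymm_TW F a) hVd (isUnit_det_TW F a) hJV (JW_eq F E a)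
            (hs a) k f)) :
    ∃ Ψ : omegaAtLine F E c N e JV hcδ hδ hd hV hVd hJV hs a χ ≃ₗ[ℂ] omegaAtLine F E c N e JV' hcδ hδ hd hV' hVd' hJV' hs' a χ,
      ∀ (k : UnitaryGroup.finAdelic F E c N JV) (x : omegaAtLine F E c N e JV hcδ hδ hd hV hVd hJV hs a χ),
        Ψ (rhoVAtLine F E c N e JV hcδ hδ hd hV hVd hJV hs a χ k x) =
          rhoVAtLine F E c N e JV' hcδ hδ hd hV' hVd' hJV' hs' a χ (finAdelicCongr F E c B hb hB k) (Ψ x) := by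
  obtain ⟨Q, hQW, hQV⟩ := hQ
  exact exists_omegaAtLine_equiv_rhoVAtLine F E c N e JV JV' hcδ hδ hd hV hV' hVd hVd' hJV hJV' hs hs' a χ Q hQW _ hQV

/-- the same from a PAIR-level conjugation hypothesis `ω′_f(s′_a(φ k, u)) = Q ∘ ω_f(s_a(k, u)) ∘ Q⁻¹`
(`φ = finAdelicCongr B`) — the shape in which `Weil1964.finRepMp` transports under conjugation of the splitting.
[cite: Liu2021, Def. 4.11 (l. 2092–2096)] [cite: GelbartRogawski1991, §3.1 Prop. 3.1.1 p. 455, Remark p. 457 L4–13] -/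
theorem exists_omegaAtLine_equiv_rhoVAtLine_of_finPairRep_conj (B : GL (Fin N) E) {b : E} (hb : b ≠ 0)
    (hB : formCongr (c : E →+* E) B (b • JV') = JV) (Q : FinSB F (Fin N × Fin 1) ≃ₗ[ℂ] FinSB F (Fin N × Fin 1))
    (hconj : ∀ (k : UnitaryGroup.finAdelic F E c N JV) (u : UnitaryGroup.finAdelic F E c 1 (JW F E a)),
      finPairRep F E c N 1 e JV' (JW F E a) hcδ hδ hd hV' (isSymm_TW F a) hVd' (isUnit_det_TW F a) hJV' (JW_eq F E a) (hs' a)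
          (finAdelicCongr F E c B hb hB k, u) =
        Q.conj (finPairRep F E c N 1 e JV (JW F E a) hcδ hδ hd hV (isSymm_TW F a) hVd (isUnit_det_TW F a) hJV (JW_eq F E a)
          (hs a) (k, u))) :
    ∃ Ψ : omegaAtLine F E c N e JV hcδ hδ hd hV hVd hJV hs a χ ≃ₗ[ℂ] omegaAtLine F E c N e JV' hcδ hδ hd hV' hVd' hJV' hs' a χ,
      ∀ (k : UnitaryGroup.finAdelic F E c N JV) (x : omegaAtLine F E c N e JV hcδ hδ hd hV hVd hJV hs a χ),
        Ψ (rhoVAtLine F E c N e JV hcδ hδ hd hV hVd hJV hs a χ k x) =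
          rhoVAtLine F E c N e JV' hcδ hδ hd hV' hVd' hJV' hs' a χ (finAdelicCongr F E c B hb hB k) (Ψ x) :=
  exists_omegaAtLine_equiv_rhoVAtLine_finAdelicCongr F E c N e JV JV' hcδ hδ hd hV hV' hVd hVd' hJV hJV' hs hs' a χ B hb hB
    ⟨Q, finPairRepW_conj_apply F E c N 1 e JV JV' (JW F E a) hcδ hδ hd hV hV' (isSymm_TW F a) hVd hVd' (isUnit_det_TW F a)
        hJV hJV' (JW_eq F E a) Q (hs a) (hs' a) (finAdelicCongr F E c B hb hB) (map_one _) hconj,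
      finPairRepV_conj_apply F E c N 1 e JV JV' (JW F E a) hcδ hδ hd hV hV' (isSymm_TW F a) hVd hVd' (isUnit_det_TW F a)
        hJV hJV' (JW_eq F E a) Q (hs a) (hs' a) (finAdelicCongr F E c B hb hB) hconj⟩

end AtLine

end Literature.NumberTheory.Automorphic.Liu2021.Def411WeilCarriers

end
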